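import Literature.AlgebraicTopology.FundamentalGroup.CellAttachmentKernel
import Literature.AlgebraicTopology.FundamentalGroup.SphereCoreComplementPi1
import HarnessLib

/-!
# Seifert–van Kampen for a path-connected open set and finitely many disjoint open pieces

Topic `Literature/AlgebraicTopology/FundamentalGroup`; a complement to `VanKampenKernel.lean`
(kernel form for two open sets), `VanKampenPushout.lean` (Lemma 1.15 and the universal property),
`SphereCoreComplementPi1.lean` (a pushout along an isomorphism is trivial) and
`CellAttachmentKernel.lean` (finitely many disjoint *cells*).  Everything here is PROVED; no
definitions, no named facts.

Let `Y ⊇ A, B₀, …, B_{r-1}` with `A` and the `Bᵢ` open, `A`, `A ∩ Bᵢ` path connected and the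
`Bᵢ` pairwise disjoint — the situation of a manifold `A` to which finitely many handles `Bᵢ`
(open pieces, meeting `A` in the connected open "attaching regions" `A ∩ Bᵢ`) are glued, e.g.
Kosinski's `M ∪ H^λ ∪ ⋯ ∪ H^λ = (M ∖ ⋃ h̄ᵢ(S)) ∪ ⋃ᵢ (Dᵐ ∖ S)ᵢ` (*Differential Manifolds* (1993),
VI §6), or a manifold from which finitely many disjoint tubes are removed.  By induction on the
number of pieces, from the two-set theorems of the tree (Hatcher, *Algebraic Topology* (2002),
Lemma 1.15, Thm. 1.20, Prop. 1.26):

* `ker_inclHomOfSubset_union_le_of_isOpen` — **one piece, kernel bound**: every normal subgroup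
  `N ⊴ π₁(A, x₁)` (`x₁ ∈ A ∩ B`) containing the image of `π₁(A ∩ B, x₁)` contains the kernel
  of `π₁(A, x₁) → π₁(A ∪ B, x₁)` (Thm. 1.20, injectivity half, `fromPath_mem_of_homotopic_refl`);
* `surjective_inclHomOfSubset_union_of_isSimplyConnected` — **one simply connected piece**:
  `π₁(A, x₁) → π₁(A ∪ B, x₁)` is onto (Lemma 1.15);
* `ker_le_and_surjective_inclHomOfSubset_union_biUnion` (a `Finset` of indices),
  `ker_le_and_surjective_inclHomOfSubset_union_iUnion` (finite index type) — **finitely many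
  pairwise disjoint simply connected pieces**: for `x₀ ∈ A`, points `x i ∈ A ∩ Bᵢ` and paths
  `η i ⊆ A` from `x₀` to `x i`, every normal subgroup `N ⊴ π₁(A, x₀)` such that `β_{η i}(N)`
  contains the image of `π₁(A ∩ Bᵢ, x i)` for every `i` contains the kernel of
  `π₁(A, x₀) → π₁(A ∪ ⋃ Bᵢ, x₀)`, and this map is onto (Prop. 1.26 (a), the shape of the
  argument: the pieces are absorbed one at a time);
* `eq_top_of_simplyConnectedSpace_of_union_iUnion_eq_univ` — hence if `A ∪ ⋃ Bᵢ = Y` is simply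
  connected, such an `N` is all of `π₁(A, x₀)`: **`π₁(A)` is normally generated by the images of
  the `π₁(A ∩ Bᵢ)`** — the form in which the fundamental group of a handlebody
  `M ∪ 2-handles` presents `π₁(M)` modulo the attaching circles (Kosinski VII §7);
* `bijective_inclHomOfSubset_union_biUnion`, `bijective_inclHomOfSubset_union_iUnion` —
  **finitely many pairwise disjoint pieces with isomorphic edges**: if each
  `π₁(A ∩ Bᵢ, x i) → π₁(Bᵢ, x i)` is bijective (and the `Bᵢ` are path connected), then
  `π₁(A, x₀) → π₁(A ∪ ⋃ Bᵢ, x₀)` is bijective (`bijective_inclHom_of_bijective_right`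
  iterated) — the form in which removing finitely many disjoint cores of tubes does not change
  `π₁` (Kosinski X §2).

## References

* A. Hatcher, *Algebraic Topology*, Cambridge Univ. Press (2002), §1.2: Lemma 1.15, Thm. 1.20,
  Prop. 1.26 and their proofs. [HatcherAT2002]
* A. A. Kosinski, *Differential Manifolds*, Academic Press (1993), VI §6, VII §7, X §2.
  [Kosinski1993]
-/

noncomputable section

open Set Function Topology unitInterval

namespace Literature.AlgebraicTopology.FundamentalGroup

namespace VanKampen

variable {Y : Type*} [TopologicalSpace Y]

/-! ### Bookkeeping -/

section Bookkeeping

variable {S : Set Y} {x₀ : Y}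

/-- The map induced by `S ⊆ S` is the identity. [folklore] -/
theorem inclHomOfSubset_refl_apply (h : S ⊆ S) (hx : x₀ ∈ S) (a : _root_.FundamentalGroup S ⟨x₀, hx⟩) :
    inclHomOfSubset h x₀ hx hx a = a := by
  induction a using PushoutData.ind_fromPath with
  | h γ =>
    rw [inclHomOfSubset_fromPath]
    exact congrArg (fun p => _root_.FundamentalGroup.fromPath (Path.Homotopic.Quotient.mk p))
      (by ext t; rfl)

/-- `π₁(↥univ, x₀) → π₁(Y, x₀)` is bijective (it is induced by the homeomorphism `↥univ ≃ₜ Y`).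
[folklore] -/
theorem bijective_inclHom_univ (x₀ : Y) :
    Bijective (inclHom (univ : Set Y) x₀ (mem_univ x₀)) := by
  set e := fundamentalGroupEquivOfHomeomorph (Homeomorph.Set.univ Y)
    (x := (⟨x₀, mem_univ x₀⟩ : ↥(univ : Set Y))) (y := x₀) rfl with he
  have heq : (inclHom (univ : Set Y) x₀ (mem_univ x₀) : _ → _) = e := by
    funext a
    rw [he, fundamentalGroupEquivOfHomeomorph_apply]
    induction a using PushoutData.ind_fromPath with
    | h γ =>
      rw [inclHom, _root_.FundamentalGroup.mapOfEq_apply, _root_.FundamentalGroup.mapOfEq_apply]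
      rfl
  rw [heq]
  exact e.bijective

/-- From the bijectivity of `π₁(A, x₀) → π₁(↥U, x₀)` for a set `U = univ` to that of
`π₁(A, x₀) → π₁(Y, x₀)`. [folklore] -/
theorem bijective_inclHom_of_bijective_inclHomOfSubset_univ {A U : Set Y} (hU : U = univ)
    (hAU : A ⊆ U) (hx : x₀ ∈ A) (h : Bijective (inclHomOfSubset hAU x₀ hx (hAU hx))) :
    Bijective (inclHom A x₀ hx) := by
  subst hU
  have hcomp : (inclHom A x₀ hx : _ → _) =
      (inclHom (univ : Set Y) x₀ (mem_univ x₀)) ∘ (inclHomOfSubset hAU x₀ hx (mem_univ x₀)) := by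
    funext a
    exact (inclHom_inclHomOfSubset hAU hx (mem_univ x₀) a).symm
  rw [hcomp]
  exact (bijective_inclHom_univ x₀).comp h

/-- If `g ∘ f` and `f` are bijective then so is `g` (for the maps induced by nested subsets
`S ⊆ S' ⊆ S''`). [folklore] -/
theorem bijective_inclHomOfSubset_of_comp {S S' S'' : Set Y} (h : S ⊆ S') (h' : S' ⊆ S'')
    (hx : x₀ ∈ S) (hf : Bijective (inclHomOfSubset h x₀ hx (h hx)))
    (hgf : Bijective (inclHomOfSubset (h.trans h') x₀ hx (h' (h hx)))) :
    Bijective (inclHomOfSubset h' x₀ (h hx) (h' (h hx))) := by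
  have hcomp : ∀ a, inclHomOfSubset h' x₀ (h hx) (h' (h hx)) (inclHomOfSubset h x₀ hx (h hx) a) =
      inclHomOfSubset (h.trans h') x₀ hx (h' (h hx)) a := fun a =>
    inclHomOfSubset_inclHomOfSubset h h' hx (h hx) (h' (h hx)) a
  constructor
  · intro b b' hbb'
    obtain ⟨a, rfl⟩ := hf.2 b
    obtain ⟨a', rfl⟩ := hf.2 b'
    rw [hcomp, hcomp] at hbb'
    rw [hgf.1 hbb']
  · intro c
    obtain ⟨a, rfl⟩ := hgf.2 c
    exact ⟨_, hcomp a⟩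

/-- **Removing finitely many closed sets with path-connected punctured open neighbourhoods keeps
a path-connected space path connected** (`isPathConnected_compl_of_nbhd` iterated): `S i` closed,
`T i ⊇ S i` open with `T i ∖ S i` path connected and `T i` disjoint from `S j` for `j ≠ i`.
[folklore] -/
theorem isPathConnected_compl_iUnion_of_nbhd {ι : Type*} [Finite ι] {S T : ι → Set Y}
    (hS : ∀ i, IsClosed (S i)) (hT : ∀ i, IsOpen (T i)) (hST : ∀ i, S i ⊆ T i)
    (hdisj : Pairwise fun i j => Disjoint (T i) (S j)) (hY : IsPathConnected (univ : Set Y))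
    (hTS : ∀ i, IsPathConnected (T i \ S i)) : IsPathConnected (⋃ i, S i)ᶜ := by
  classical
  cases nonempty_fintype ι
  suffices H : ∀ s : Finset ι, IsPathConnected (⋃ i ∈ s, S i)ᶜ by
    have e : (⋃ i ∈ (Finset.univ : Finset ι), S i) = ⋃ i, S i := by ext y; simp
    rw [← e]
    exact H Finset.univ
  intro s
  induction s using Finset.induction_on with
  | empty => simpa using hY
  | insert i s his ih =>
    -- in the subspace `W = (⋃_{j ∈ s} S j)ᶜ` remove `S i`
    set W : Set Y := (⋃ j ∈ s, S j)ᶜ with hW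
    have hTW : T i ⊆ W := by
      intro y hy hy'
      simp only [mem_iUnion, exists_prop] at hy'
      obtain ⟨j, hj, hyj⟩ := hy'
      have hne : i ≠ j := fun e => his (e ▸ hj)
      exact Set.disjoint_left.1 (hdisj hne) hy hyj
    have hW' : IsPathConnected (univ : Set ↥W) := by
      have := ih.preimage_coe (subset_refl W)
      rwa [Subtype.coe_preimage_self] at this
    have hS' : IsClosed (Subtype.val ⁻¹' S i : Set ↥W) := (hS i).preimage continuous_subtype_val
    have hT' : IsOpen (Subtype.val ⁻¹' T i : Set ↥W) := (hT i).preimage continuous_subtype_val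
    have hST' : (Subtype.val ⁻¹' S i : Set ↥W) ⊆ Subtype.val ⁻¹' T i := fun w hw => hST i hw
    have hTS' : IsPathConnected ((Subtype.val ⁻¹' T i : Set ↥W) \ Subtype.val ⁻¹' S i) := by
      have := (hTS i).preimage_coe (Set.sdiff_subset.trans hTW)
      exact this
    have h := isPathConnected_compl_of_nbhd hS' hT' hST' hW' hTS'
    have himage := h.image (f := (Subtype.val : ↥W → Y)) continuous_subtype_val
    have e : Subtype.val '' (Subtype.val ⁻¹' S i : Set ↥W)ᶜ = (⋃ j ∈ insert i s, S j)ᶜ := by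
      rw [Finset.set_biUnion_insert, compl_union, ← hW, inter_comm]
      ext y
      simp only [mem_image, mem_compl_iff, mem_preimage, mem_inter_iff, Subtype.exists,
        exists_and_right, exists_eq_right]
      constructor
      · rintro ⟨hyW, hyS⟩; exact ⟨hyW, hyS⟩
      · rintro ⟨hyW, hyS⟩; exact ⟨hyW, hyS⟩
    rwa [e] at himage

/-- The kernel of `π₁(S, x) → π₁(S', x)` does not depend on the base point within a path
component of `S`, in the form: `a ∈ ker` at `x₁` iff `β_δ⁻¹ a ∈ ker` at `x₀` — stated as the
transport of an upper bound by a normal subgroup along `β_δ`. [cite: HatcherAT2002, Prop. 1.5] -/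
theorem ker_inclHomOfSubset_le_map_of_path {S S' : Set Y} (hS : S ⊆ S') {x₀ x₁ : Y} (hx₀ : x₀ ∈ S)
    (hx₁ : x₁ ∈ S) (δ : Path x₀ x₁) (hδ : ∀ t, δ t ∈ S) (N : Subgroup (_root_.FundamentalGroup S ⟨x₀, hx₀⟩))
    (hN : (inclHomOfSubset hS x₀ hx₀ (hS hx₀)).ker ≤ N) :
    (inclHomOfSubset hS x₁ hx₁ (hS hx₁)).ker ≤
      N.map (_root_.FundamentalGroup.fundamentalGroupMulEquivOfPath (liftPath S δ hδ)).toMonoidHom := by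
  intro b hb
  set β := _root_.FundamentalGroup.fundamentalGroupMulEquivOfPath (liftPath S δ hδ) with hβ
  obtain ⟨a, rfl⟩ := β.surjective b
  rw [MonoidHom.mem_ker, hβ, inclHomOfSubset_fundamentalGroupMulEquivOfPath hS hx₀ hx₁ δ hδ,
    MulEquiv.map_eq_one_iff] at hb
  exact Subgroup.mem_map_of_mem _ (hN hb)

/-- Surjectivity of `π₁(S, x) → π₁(S', x)` does not depend on the base point within a path
component of `S`. [cite: HatcherAT2002, Prop. 1.5] -/
theorem surjective_inclHomOfSubset_iff_of_path {S S' : Set Y} (hS : S ⊆ S') {x₀ x₁ : Y}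
    (hx₀ : x₀ ∈ S) (hx₁ : x₁ ∈ S) (δ : Path x₀ x₁) (hδ : ∀ t, δ t ∈ S) :
    Surjective (inclHomOfSubset hS x₀ hx₀ (hS hx₀)) ↔
      Surjective (inclHomOfSubset hS x₁ hx₁ (hS hx₁)) :=
  surjective_iff_of_mulEquiv_comm _ _
    (_root_.FundamentalGroup.fundamentalGroupMulEquivOfPath (liftPath S δ hδ))
    (_root_.FundamentalGroup.fundamentalGroupMulEquivOfPath (liftPath S' δ fun t => hS (hδ t)))
    (inclHomOfSubset_fundamentalGroupMulEquivOfPath hS hx₀ hx₁ δ hδ)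

/-- Injectivity of `π₁(S, x) → π₁(S', x)` does not depend on the base point within a path
component of `S`. [cite: HatcherAT2002, Prop. 1.5] -/
theorem injective_inclHomOfSubset_iff_of_path {S S' : Set Y} (hS : S ⊆ S') {x₀ x₁ : Y}
    (hx₀ : x₀ ∈ S) (hx₁ : x₁ ∈ S) (δ : Path x₀ x₁) (hδ : ∀ t, δ t ∈ S) :
    Injective (inclHomOfSubset hS x₀ hx₀ (hS hx₀)) ↔
      Injective (inclHomOfSubset hS x₁ hx₁ (hS hx₁)) :=
  injective_iff_of_mulEquiv_comm _ _
    (_root_.FundamentalGroup.fundamentalGroupMulEquivOfPath (liftPath S δ hδ))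
    (_root_.FundamentalGroup.fundamentalGroupMulEquivOfPath (liftPath S' δ fun t => hS (hδ t)))
    (inclHomOfSubset_fundamentalGroupMulEquivOfPath hS hx₀ hx₁ δ hδ)

/-- A union `A ∪ ⋃_{i ∈ s} B i` of path-connected sets each of which meets the path-connected
set `A` is path connected. [folklore] -/
theorem isPathConnected_union_biUnion {ι : Type*} {A : Set Y} {B : ι → Set Y}
    (hA : IsPathConnected A) (hB : ∀ i, IsPathConnected (B i)) (hmeet : ∀ i, (A ∩ B i).Nonempty)
    (s : Finset ι) : IsPathConnected (A ∪ ⋃ i ∈ s, B i) := by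
  classical
  induction s using Finset.induction_on with
  | empty => simpa using hA
  | insert i s hi ih =>
    rw [Finset.set_biUnion_insert, union_left_comm]
    refine IsPathConnected.union (hB i) ih ?_
    obtain ⟨y, hyA, hyB⟩ := hmeet i
    exact ⟨y, hyB, Or.inl hyA⟩

/-- A union `A ∪ ⋃_{i ∈ s} B i` of open sets is open. [folklore] -/
theorem isOpen_union_biUnion {ι : Type*} {A : Set Y} {B : ι → Set Y} (hA : IsOpen A)
    (hB : ∀ i, IsOpen (B i)) (s : Finset ι) : IsOpen (A ∪ ⋃ i ∈ s, B i) :=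
  hA.union (isOpen_biUnion fun i _ => hB i)

omit [TopologicalSpace Y] in
/-- With pairwise disjoint `B i` and `i ∉ s`: `(A ∪ ⋃_{j ∈ s} B j) ∩ B i = A ∩ B i`.
[folklore] -/
theorem union_biUnion_inter_eq {ι : Type*} {A : Set Y} {B : ι → Set Y}
    (hdisj : Pairwise fun i j => Disjoint (B i) (B j)) {s : Finset ι} {i : ι} (hi : i ∉ s) :
    (A ∪ ⋃ j ∈ s, B j) ∩ B i = A ∩ B i := by
  ext y
  simp only [mem_inter_iff, mem_union, mem_iUnion, exists_prop]
  constructor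
  · rintro ⟨h | ⟨j, hj, hy⟩, hyi⟩
    · exact ⟨h, hyi⟩
    · exfalso
      have hne : j ≠ i := fun e => hi (e ▸ hj)
      exact Set.disjoint_left.1 (hdisj hne) hy hyi
  · rintro ⟨h, hyi⟩
    exact ⟨Or.inl h, hyi⟩

end Bookkeeping

/-! ### One open piece -/

section OnePiece

variable {A B : Set Y} {x₁ : Y}

/-- **Kernel bound for one open piece** (Hatcher, Thm. 1.20, injectivity half, in the form of
Prop. 1.26: *"`π₁` is the quotient of `π₁(A)` by the normal subgroup generated by the image of
`π₁(A ∩ B) → π₁(A)`"*).  Let `A`, `B ⊆ Y` be open with `A`, `B`, `A ∩ B` path connected and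
`x₁ ∈ A ∩ B`.  Then every normal subgroup `N` of `π₁(A, x₁)` containing the image of
`π₁(A ∩ B, x₁) → π₁(A, x₁)` contains the kernel of `π₁(A, x₁) → π₁(A ∪ B, x₁)` (van Kampen in
kernel form, `fromPath_mem_of_homotopic_refl`, in the subspace `A ∪ B` covered by the traces of
`A` and `B`). [cite: HatcherAT2002, Thm. 1.20] -/
theorem ker_inclHomOfSubset_union_le_of_isOpen (hAo : IsOpen A) (hBo : IsOpen B)
    (hApc : IsPathConnected A) (hmeet : IsPathConnected (A ∩ B)) (hx₁ : x₁ ∈ A ∩ B)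
    (N : Subgroup (_root_.FundamentalGroup A ⟨x₁, hx₁.1⟩)) [N.Normal]
    (hN : Set.range (inclHomOfSubset (inter_subset_left : A ∩ B ⊆ A) x₁ hx₁ hx₁.1) ⊆ N) :
    (inclHomOfSubset (subset_union_left : A ⊆ A ∪ B) x₁ hx₁.1 (subset_union_left hx₁.1)).ker ≤
      N := by
  -- the traces of `A`, `B` on the subspace `W = A ∪ B`
  set U : Set ↥(A ∪ B) := Subtype.val ⁻¹' A with hUdef
  set T : Set ↥(A ∪ B) := Subtype.val ⁻¹' B with hTdef
  have hUo : IsOpen U := hAo.preimage continuous_subtype_val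
  have hTo : IsOpen T := hBo.preimage continuous_subtype_val
  have hUT : U ∪ T = univ := by
    ext w
    simp only [mem_union, hUdef, hTdef, mem_preimage, mem_univ, iff_true]
    exact w.2
  have hUpc : IsPathConnected U := hApc.preimage_coe subset_union_left
  have hmeet' : IsPathConnected (U ∩ T) :=
    hmeet.preimage_coe (inter_subset_left.trans subset_union_left)
  set x₁' : ↥(A ∪ B) := ⟨x₁, subset_union_left hx₁.1⟩ with hx₁'def
  have hx₁U : x₁' ∈ U := hx₁.1
  have hx₁T : x₁' ∈ T := hx₁.2
  have hx₁C : x₁' ∈ (Subtype.val ⁻¹' (A ∩ B) : Set ↥(A ∪ B)) := hx₁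
  have hCU : (Subtype.val ⁻¹' (A ∩ B) : Set ↥(A ∪ B)) ⊆ U := fun _ hw => hw.1
  -- the transport isomorphisms
  obtain ⟨θC, θA, -, hθA, hθ⟩ := exists_mulEquiv_preimageVal_comm
    (inter_subset_left : A ∩ B ⊆ A) (subset_union_left : A ⊆ A ∪ B) hx₁
  -- the normal subgroup of `π₁(U, x₁)`
  set N₂ : Subgroup (_root_.FundamentalGroup ↥U ⟨x₁', hx₁U⟩) := N.map θA.toMonoidHom with hN₂
  haveI hN₂n : N₂.Normal := Subgroup.Normal.map inferInstance _ θA.surjective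
  -- it contains the classes of the loops of `U` inside `T`
  have hN₂T : ∀ ℓ : Path (⟨x₁', hx₁U⟩ : ↥U) ⟨x₁', hx₁U⟩, (∀ t, (ℓ t : ↥(A ∪ B)) ∈ T) →
      _root_.FundamentalGroup.fromPath (Path.Homotopic.Quotient.mk ℓ) ∈ N₂ := by
    intro ℓ hℓT
    have hℓC : ∀ t, (ℓ.map continuous_subtype_val) t ∈ (Subtype.val ⁻¹' (A ∩ B) : Set ↥(A ∪ B)) :=
      fun t => ⟨(ℓ t).2, hℓT t⟩
    set ℓC := liftPath (Subtype.val ⁻¹' (A ∩ B) : Set ↥(A ∪ B)) (ℓ.map continuous_subtype_val) hℓC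
      with hℓC'
    have e₁ : _root_.FundamentalGroup.fromPath (Path.Homotopic.Quotient.mk ℓ) =
        inclHomOfSubset hCU x₁' hx₁C hx₁U
          (_root_.FundamentalGroup.fromPath (Path.Homotopic.Quotient.mk ℓC)) := by
      rw [hℓC', inclHomOfSubset_fromPath_liftPath]
      congr 2
    set c := θC.symm (_root_.FundamentalGroup.fromPath (Path.Homotopic.Quotient.mk ℓC)) with hc
    have e₂ : _root_.FundamentalGroup.fromPath (Path.Homotopic.Quotient.mk ℓC) = θC c := by
      rw [hc, MulEquiv.apply_symm_apply]
    have e₃ : inclHomOfSubset hCU x₁' hx₁C hx₁U (θC c) =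
        θA (inclHomOfSubset (inter_subset_left : A ∩ B ⊆ A) x₁ hx₁ hx₁.1 c) := hθ c
    rw [e₁, e₂, e₃, hN₂]
    exact Subgroup.mem_map_of_mem _ (hN (mem_range_self c))
  -- the kernel
  intro a ha
  rw [MonoidHom.mem_ker] at ha
  have hθa : inclHom U x₁' hx₁U (θA a) = 1 := by rw [hθA a, ha]
  obtain ⟨ℓ, hℓ⟩ : ∃ ℓ : Path (⟨x₁', hx₁U⟩ : ↥U) ⟨x₁', hx₁U⟩,
      _root_.FundamentalGroup.fromPath (Path.Homotopic.Quotient.mk ℓ) = θA a := by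
    induction θA a using PushoutData.ind_fromPath with
    | h γ => exact ⟨γ, rfl⟩
  have hnull : (ℓ.map continuous_subtype_val).Homotopic (Path.refl x₁') := by
    rw [← inclHom_fromPath_eq_one_iff hx₁U, hℓ]
    exact hθa
  have hmem := fromPath_mem_of_homotopic_refl hUo hTo hUT hUpc hmeet' hx₁U hx₁T N₂ hN₂T ℓ hnull
  rw [hℓ, hN₂, Subgroup.mem_map] at hmem
  obtain ⟨n, hn, hna⟩ := hmem
  rwa [← θA.injective hna]

/-- **One simply connected open piece: `π₁(A) → π₁(A ∪ B)` is onto** (Hatcher, Lemma 1.15: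
`π₁(A ∪ B)` is generated by the images of `π₁(A)` and `π₁(B)`, and the latter is trivial).
Here `A`, `B` are open, `A`, `A ∩ B` path connected, `B` simply connected, `x₁ ∈ A ∩ B`.
[cite: HatcherAT2002, Lemma 1.15] -/
theorem surjective_inclHomOfSubset_union_of_isSimplyConnected (hAo : IsOpen A) (hBo : IsOpen B)
    (hApc : IsPathConnected A) (hB : IsSimplyConnected B) (hmeet : IsPathConnected (A ∩ B))
    (hx₁ : x₁ ∈ A ∩ B) :
    Surjective (inclHomOfSubset (subset_union_left : A ⊆ A ∪ B) x₁ hx₁.1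
      (subset_union_left hx₁.1)) := by
  set U : Set ↥(A ∪ B) := Subtype.val ⁻¹' A with hUdef
  set T : Set ↥(A ∪ B) := Subtype.val ⁻¹' B with hTdef
  have hUo : IsOpen U := hAo.preimage continuous_subtype_val
  have hTo : IsOpen T := hBo.preimage continuous_subtype_val
  have hUT : U ∪ T = univ := by
    ext w
    simp only [mem_union, hUdef, hTdef, mem_preimage, mem_univ, iff_true]
    exact w.2
  have hUpc : IsPathConnected U := hApc.preimage_coe subset_union_left
  have hTpc : IsPathConnected T := hB.isPathConnected.preimage_coe subset_union_right
  have hmeet' : IsPathConnected (U ∩ T) :=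
    hmeet.preimage_coe (inter_subset_left.trans subset_union_left)
  set x₁' : ↥(A ∪ B) := ⟨x₁, subset_union_left hx₁.1⟩ with hx₁'def
  have hx₁U : x₁' ∈ U := hx₁.1
  have hx₁T : x₁' ∈ T := hx₁.2
  -- `π₁(T)` is trivial
  have hTsc : IsSimplyConnected T := by
    rw [hTdef, ← IsEmbedding.subtypeVal.isSimplyConnected_image, Subtype.image_preimage_coe,
      inter_eq_right.2 subset_union_right]
    exact hB
  haveI : Subsingleton (_root_.FundamentalGroup ↥T ⟨x₁', hx₁T⟩) := by
    haveI := hTsc.simplyConnectedSpace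
    infer_instance
  -- Lemma 1.15
  have hgen := closure_range_inclHom_union_eq_top hUo hTo hUT hx₁U hx₁T hUpc hTpc hmeet'
  have hU : Surjective (inclHom U x₁' hx₁U) := by
    rw [← MonoidHom.range_eq_top, eq_top_iff, ← hgen, Subgroup.closure_le]
    rintro g (⟨a, rfl⟩ | ⟨t, rfl⟩)
    · exact ⟨a, rfl⟩
    · rw [Subsingleton.elim t 1, map_one]
      exact one_mem _
  exact (surjective_inclHomOfSubset_iff_preimageVal (subset_union_left : A ⊆ A ∪ B) hx₁.1).2 hU

/-- **One open piece with an isomorphic edge: `π₁(A) → π₁(A ∪ B)` is bijective** if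
`π₁(A ∩ B, x₁) → π₁(B, x₁)` is (`A`, `B` open, `A`, `B`, `A ∩ B` path connected; the pushout
of van Kampen's theorem along an isomorphism, `bijective_inclHom_of_bijective_right`, read for
subsets of `Y`). [cite: HatcherAT2002, Thm. 1.20] -/
theorem bijective_inclHomOfSubset_union_of_bijective (hAo : IsOpen A) (hBo : IsOpen B)
    (hApc : IsPathConnected A) (hBpc : IsPathConnected B) (hmeet : IsPathConnected (A ∩ B))
    (hx₁ : x₁ ∈ A ∩ B)
    (hbij : Bijective (inclHomOfSubset (inter_subset_right : A ∩ B ⊆ B) x₁ hx₁ hx₁.2)) :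
    Bijective (inclHomOfSubset (subset_union_left : A ⊆ A ∪ B) x₁ hx₁.1
      (subset_union_left hx₁.1)) := by
  set U : Set ↥(A ∪ B) := Subtype.val ⁻¹' A with hUdef
  set T : Set ↥(A ∪ B) := Subtype.val ⁻¹' B with hTdef
  have hUo : IsOpen U := hAo.preimage continuous_subtype_val
  have hTo : IsOpen T := hBo.preimage continuous_subtype_val
  have hUT : U ∪ T = univ := by
    ext w
    simp only [mem_union, hUdef, hTdef, mem_preimage, mem_univ, iff_true]
    exact w.2
  have hUpc : IsPathConnected U := hApc.preimage_coe subset_union_left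
  have hTpc : IsPathConnected T := hBpc.preimage_coe subset_union_right
  have hmeet' : IsPathConnected (U ∩ T) :=
    hmeet.preimage_coe (inter_subset_left.trans subset_union_left)
  set x₁' : ↥(A ∪ B) := ⟨x₁, subset_union_left hx₁.1⟩ with hx₁'def
  have hx₁U : x₁' ∈ U := hx₁.1
  have hx₁T : x₁' ∈ T := hx₁.2
  -- the edge `π₁(U ∩ T) → π₁(T)` is bijective, transported from `π₁(A ∩ B) → π₁(B)`
  obtain ⟨θC, θB, -, -, hθ⟩ := exists_mulEquiv_preimageVal_comm
    (inter_subset_right : A ∩ B ⊆ B) (subset_union_right : B ⊆ A ∪ B) hx₁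
  have hjT' : Bijective (inclHomOfSubset
      (fun _ hw => hw.2 : (Subtype.val ⁻¹' (A ∩ B) : Set ↥(A ∪ B)) ⊆ Subtype.val ⁻¹' B)
      x₁' hx₁ hx₁.2) :=
    ⟨(injective_iff_of_mulEquiv_comm _ _ θC θB hθ).1 hbij.1,
      (surjective_iff_of_mulEquiv_comm _ _ θC θB hθ).1 hbij.2⟩
  have hCeq : (Subtype.val ⁻¹' (A ∩ B) : Set ↥(A ∪ B)) = U ∩ T := rfl
  have hjT : Bijective (inclHomOfSubset (inter_subset_right : U ∩ T ⊆ T) x₁' ⟨hx₁U, hx₁T⟩ hx₁T) :=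
    ⟨(injective_inclHomOfSubset_congr' hCeq rfl _ _ hx₁ ⟨hx₁U, hx₁T⟩).1 hjT'.1,
      (surjective_inclHomOfSubset_congr' hCeq rfl _ _ hx₁ ⟨hx₁U, hx₁T⟩).1 hjT'.2⟩
  have hU := bijective_inclHom_of_bijective_right hUo hTo hUT hx₁U hx₁T hUpc hTpc hmeet' hjT
  exact ⟨(injective_inclHomOfSubset_iff_preimageVal (subset_union_left : A ⊆ A ∪ B) hx₁.1).2 hU.1,
    (surjective_inclHomOfSubset_iff_preimageVal (subset_union_left : A ⊆ A ∪ B) hx₁.1).2 hU.2⟩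

end OnePiece

/-! ### Finitely many pairwise disjoint simply connected open pieces -/

section Pieces

variable {ι : Type*} {A : Set Y} {B : ι → Set Y} {x₀ : Y}

/-- **Kernel bound and surjectivity for finitely many pairwise disjoint simply connected open
pieces** (a `Finset` of indices; Hatcher, Prop. 1.26 (a), the shape of the proof: the pieces are
absorbed one at a time into `A`).  Let `A` be open and path connected, `B i` open, simply
connected, pairwise disjoint, with `A ∩ B i` path connected; `x₀ ∈ A`; `x i ∈ A ∩ B i` and
`η i ⊆ A` a path from `x₀` to `x i`.  If `N ⊴ π₁(A, x₀)` is normal and, moved to `x i` along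
`η i`, contains the image of `π₁(A ∩ B i, x i)` for each `i`, then for every finite set `s` of
indices `N` contains the kernel of `π₁(A, x₀) → π₁(A ∪ ⋃_{i ∈ s} B i, x₀)`, and this map is
surjective. [cite: HatcherAT2002, Prop. 1.26 (a) and proof (pp. 50–51)] -/
theorem ker_le_and_surjective_inclHomOfSubset_union_biUnion (hAo : IsOpen A)
    (hBo : ∀ i, IsOpen (B i)) (hApc : IsPathConnected A) (hBsc : ∀ i, IsSimplyConnected (B i))
    (hmeet : ∀ i, IsPathConnected (A ∩ B i)) (hdisj : Pairwise fun i j => Disjoint (B i) (B j))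
    (hx₀ : x₀ ∈ A) (N : Subgroup (_root_.FundamentalGroup A ⟨x₀, hx₀⟩)) [N.Normal]
    (x : ι → Y) (hx : ∀ i, x i ∈ A ∩ B i) (η : ∀ i, Path x₀ (x i)) (hη : ∀ i t, η i t ∈ A)
    (hN : ∀ i, Set.range (inclHomOfSubset (inter_subset_left : A ∩ B i ⊆ A) (x i) (hx i) (hx i).1) ⊆
      N.map (_root_.FundamentalGroup.fundamentalGroupMulEquivOfPath
        (liftPath A (η i) (hη i))).toMonoidHom)
    (s : Finset ι) :
    (inclHomOfSubset (subset_union_left : A ⊆ A ∪ ⋃ i ∈ s, B i) x₀ hx₀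
        (subset_union_left hx₀)).ker ≤ N ∧
      Surjective (inclHomOfSubset (subset_union_left : A ⊆ A ∪ ⋃ i ∈ s, B i) x₀ hx₀
        (subset_union_left hx₀)) := by
  classical
  induction s using Finset.induction_on with
  | empty =>
    have e : A ∪ ⋃ i ∈ (∅ : Finset ι), B i = A := by simp
    constructor
    · rw [ker_inclHomOfSubset_congr e _ subset_rfl hx₀]
      intro a ha
      rw [MonoidHom.mem_ker, inclHomOfSubset_refl_apply] at ha
      rw [ha]
      exact one_mem N
    · rw [surjective_inclHomOfSubset_congr e _ subset_rfl hx₀]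
      intro a
      exact ⟨a, inclHomOfSubset_refl_apply _ hx₀ a⟩
  | insert i s his ih =>
    obtain ⟨ihker, ihsurj⟩ := ih
    -- the set `A' = A ∪ ⋃_{j ∈ s} B j` and the new piece `B i`
    set A' : Set Y := A ∪ ⋃ j ∈ s, B j with hA'
    have e : A ∪ ⋃ j ∈ insert i s, B j = A' ∪ B i := by
      rw [Finset.set_biUnion_insert, hA', union_assoc, union_comm (B i)]
    have hAA' : A ⊆ A' := subset_union_left
    have hA'o : IsOpen A' := isOpen_union_biUnion hAo hBo s
    have hA'pc : IsPathConnected A' :=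
      isPathConnected_union_biUnion hApc (fun j => (hBsc j).isPathConnected)
        (fun j => ⟨x j, hx j⟩) s
    have hinter : A' ∩ B i = A ∩ B i := union_biUnion_inter_eq hdisj his
    have hmeet' : IsPathConnected (A' ∩ B i) := by rw [hinter]; exact hmeet i
    have hxi : x i ∈ A' ∩ B i := by rw [hinter]; exact hx i
    -- the maps
    set jx : _root_.FundamentalGroup A ⟨x i, (hx i).1⟩ →* _root_.FundamentalGroup A' ⟨x i, hAA' (hx i).1⟩ :=
      inclHomOfSubset hAA' (x i) (hx i).1 (hAA' (hx i).1) with hjx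
    set j₀ : _root_.FundamentalGroup A ⟨x₀, hx₀⟩ →* _root_.FundamentalGroup A' ⟨x₀, hAA' hx₀⟩ :=
      inclHomOfSubset hAA' x₀ hx₀ (hAA' hx₀) with hj₀
    set βA := _root_.FundamentalGroup.fundamentalGroupMulEquivOfPath (liftPath A (η i) (hη i))
      with hβA
    set βA' := _root_.FundamentalGroup.fundamentalGroupMulEquivOfPath
      (liftPath A' (η i) fun t => hAA' (hη i t)) with hβA'
    have hnat : ∀ a, jx (βA a) = βA' (j₀ a) := fun a =>
      inclHomOfSubset_fundamentalGroupMulEquivOfPath hAA' hx₀ (hx i).1 (η i) (hη i) a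
    -- the normal subgroup `N' = β (j₀ N)` of `π₁(A', x i)`
    set N' : Subgroup (_root_.FundamentalGroup A' ⟨x i, hAA' (hx i).1⟩) :=
      (N.map j₀).map βA'.toMonoidHom with hN'
    haveI hN₀n : (N.map j₀).Normal := Subgroup.Normal.map inferInstance _ ihsurj
    haveI hN'n : N'.Normal := Subgroup.Normal.map hN₀n _ βA'.surjective
    -- it contains the image of `π₁(A' ∩ B i, x i)`
    have hN'C : Set.range (inclHomOfSubset (inter_subset_left : A' ∩ B i ⊆ A') (x i) hxi hxi.1) ⊆
        N' := by
      rw [range_inclHomOfSubset_congr hinter (inter_subset_left : A' ∩ B i ⊆ A')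
        (inter_subset_left.trans hAA') hxi (hx i) hxi.1]
      rintro _ ⟨c, rfl⟩
      rw [← inclHomOfSubset_inclHomOfSubset (inter_subset_left : A ∩ B i ⊆ A) hAA' (hx i)
        (hx i).1 (hAA' (hx i).1)]
      obtain ⟨n, hn, hnc⟩ := Subgroup.mem_map.1 (hN i (mem_range_self c))
      rw [← hnc]
      change jx (βA n) ∈ N'
      rw [hnat, hN']
      exact Subgroup.mem_map_of_mem _ (Subgroup.mem_map_of_mem _ hn)
    -- one piece
    have hker' := ker_inclHomOfSubset_union_le_of_isOpen hA'o (hBo i) hA'pc hmeet' hxi N' hN'C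
    have hsurj' := surjective_inclHomOfSubset_union_of_isSimplyConnected hA'o (hBo i) hA'pc
      (hBsc i) hmeet' hxi
    -- back to the base point `x₀`
    set q : _root_.FundamentalGroup A' ⟨x₀, hAA' hx₀⟩ →*
        _root_.FundamentalGroup ↥(A' ∪ B i) ⟨x₀, subset_union_left (hAA' hx₀)⟩ :=
      inclHomOfSubset (subset_union_left : A' ⊆ A' ∪ B i) x₀ (hAA' hx₀)
        (subset_union_left (hAA' hx₀)) with hq
    have hqker : q.ker ≤ N.map j₀ := by
      intro b hb
      have hb' : βA' b ∈ (inclHomOfSubset (subset_union_left : A' ⊆ A' ∪ B i) (x i) hxi.1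
          (subset_union_left hxi.1)).ker := by
        rw [MonoidHom.mem_ker, hβA',
          inclHomOfSubset_fundamentalGroupMulEquivOfPath (subset_union_left : A' ⊆ A' ∪ B i)
            (hAA' hx₀) hxi.1 (η i) (fun t => hAA' (hη i t)) b, MulEquiv.map_eq_one_iff]
        exact hb
      have hb'' := hker' hb'
      rw [hN', Subgroup.mem_map] at hb''
      obtain ⟨n, hn, hnb⟩ := hb''
      rwa [← βA'.injective hnb]
    have hqsurj : Surjective q :=
      (surjective_inclHomOfSubset_iff_of_path (subset_union_left : A' ⊆ A' ∪ B i) (hAA' hx₀)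
        hxi.1 (η i) (fun t => hAA' (hη i t))).2 hsurj'
    -- compose
    have hcomp : ∀ a, inclHomOfSubset (hAA'.trans (subset_union_left : A' ⊆ A' ∪ B i)) x₀ hx₀
        (subset_union_left (hAA' hx₀)) a = q (j₀ a) := fun a =>
      (inclHomOfSubset_inclHomOfSubset hAA' (subset_union_left : A' ⊆ A' ∪ B i) hx₀ (hAA' hx₀)
        (subset_union_left (hAA' hx₀)) a).symm
    constructor
    · rw [ker_inclHomOfSubset_congr e _ (hAA'.trans (subset_union_left : A' ⊆ A' ∪ B i)) hx₀]
      intro a ha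
      rw [MonoidHom.mem_ker, hcomp] at ha
      have hja : j₀ a ∈ N.map j₀ := hqker ha
      obtain ⟨n, hn, hna⟩ := Subgroup.mem_map.1 hja
      have hker₀ : a * n⁻¹ ∈ N := by
        apply ihker
        rw [MonoidHom.mem_ker, map_mul, map_inv, hna, mul_inv_cancel]
      have := N.mul_mem hker₀ hn
      rwa [inv_mul_cancel_right] at this
    · rw [surjective_inclHomOfSubset_congr e _ (hAA'.trans (subset_union_left : A' ⊆ A' ∪ B i)) hx₀]
      intro c
      obtain ⟨b, rfl⟩ := hqsurj c
      obtain ⟨a, rfl⟩ := ihsurj b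
      exact ⟨a, hcomp a⟩

/-- **Kernel bound and surjectivity for a finite family of pairwise disjoint simply connected
open pieces** (`ker_le_and_surjective_inclHomOfSubset_union_biUnion` for all indices of a finite
type). [cite: HatcherAT2002, Prop. 1.26 (a) and proof (pp. 50–51)] -/
theorem ker_le_and_surjective_inclHomOfSubset_union_iUnion [Finite ι] (hAo : IsOpen A)
    (hBo : ∀ i, IsOpen (B i)) (hApc : IsPathConnected A) (hBsc : ∀ i, IsSimplyConnected (B i))
    (hmeet : ∀ i, IsPathConnected (A ∩ B i)) (hdisj : Pairwise fun i j => Disjoint (B i) (B j))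
    (hx₀ : x₀ ∈ A) (N : Subgroup (_root_.FundamentalGroup A ⟨x₀, hx₀⟩)) [N.Normal]
    (x : ι → Y) (hx : ∀ i, x i ∈ A ∩ B i) (η : ∀ i, Path x₀ (x i)) (hη : ∀ i t, η i t ∈ A)
    (hN : ∀ i, Set.range (inclHomOfSubset (inter_subset_left : A ∩ B i ⊆ A) (x i) (hx i) (hx i).1) ⊆
      N.map (_root_.FundamentalGroup.fundamentalGroupMulEquivOfPath
        (liftPath A (η i) (hη i))).toMonoidHom) :
    (inclHomOfSubset (subset_union_left : A ⊆ A ∪ ⋃ i, B i) x₀ hx₀ (subset_union_left hx₀)).ker ≤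
        N ∧
      Surjective (inclHomOfSubset (subset_union_left : A ⊆ A ∪ ⋃ i, B i) x₀ hx₀
        (subset_union_left hx₀)) := by
  classical
  cases nonempty_fintype ι
  have e : A ∪ ⋃ i ∈ (Finset.univ : Finset ι), B i = A ∪ ⋃ i, B i := by
    ext y; simp
  obtain ⟨hker, hsurj⟩ := ker_le_and_surjective_inclHomOfSubset_union_biUnion hAo hBo hApc hBsc
    hmeet hdisj hx₀ N x hx η hη hN Finset.univ
  exact ⟨by rwa [ker_inclHomOfSubset_congr e _ subset_union_left hx₀] at hker,
    by rwa [surjective_inclHomOfSubset_congr e _ subset_union_left hx₀] at hsurj⟩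

/-- **`π₁(A)` is normally generated by the images of the `π₁(A ∩ Bᵢ)` when `A ∪ ⋃ Bᵢ = Y` is
simply connected.**  In the situation of `ker_le_and_surjective_inclHomOfSubset_union_iUnion`,
if the pieces cover `Y` and `Y` is simply connected, then the normal subgroup `N` is all of
`π₁(A, x₀)` (every class dies in `Y`).  For `A = M ∖ ⋃ h̄ᵢ(S)` and the handles
`Bᵢ = (Dᵐ ∖ S)ᵢ` of a simply connected `M ∪ H² ∪ ⋯ ∪ H²` this is Kosinski's remark that
`π₁` is presented by `π₁(M)` and the attaching circles (VII §7). [cite: HatcherAT2002, Prop. 1.26 (a)] -/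
theorem eq_top_of_simplyConnectedSpace_of_union_iUnion_eq_univ [Finite ι] [SimplyConnectedSpace Y]
    (hAo : IsOpen A) (hBo : ∀ i, IsOpen (B i)) (hApc : IsPathConnected A)
    (hBsc : ∀ i, IsSimplyConnected (B i)) (hmeet : ∀ i, IsPathConnected (A ∩ B i))
    (hdisj : Pairwise fun i j => Disjoint (B i) (B j)) (hcov : A ∪ ⋃ i, B i = univ)
    (hx₀ : x₀ ∈ A) (N : Subgroup (_root_.FundamentalGroup A ⟨x₀, hx₀⟩)) [N.Normal]
    (x : ι → Y) (hx : ∀ i, x i ∈ A ∩ B i) (η : ∀ i, Path x₀ (x i)) (hη : ∀ i t, η i t ∈ A)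
    (hN : ∀ i, Set.range (inclHomOfSubset (inter_subset_left : A ∩ B i ⊆ A) (x i) (hx i) (hx i).1) ⊆
      N.map (_root_.FundamentalGroup.fundamentalGroupMulEquivOfPath
        (liftPath A (η i) (hη i))).toMonoidHom) :
    N = ⊤ := by
  obtain ⟨hker, -⟩ := ker_le_and_surjective_inclHomOfSubset_union_iUnion hAo hBo hApc hBsc hmeet
    hdisj hx₀ N x hx η hη hN
  have hsc : IsSimplyConnected (A ∪ ⋃ i, B i) := by
    rw [hcov]
    exact (Homeomorph.Set.univ Y).toHomotopyEquiv.simplyConnectedSpace_iff.2 inferInstance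
  haveI : Subsingleton (_root_.FundamentalGroup ↥(A ∪ ⋃ i, B i) ⟨x₀, subset_union_left hx₀⟩) := by
    haveI := hsc.simplyConnectedSpace
    infer_instance
  rw [eq_top_iff]
  intro a _
  apply hker
  rw [MonoidHom.mem_ker]
  exact Subsingleton.elim _ _

/-! ### Finitely many pairwise disjoint open pieces with isomorphic edges -/

/-- **Bijectivity for finitely many pairwise disjoint open pieces with isomorphic edges** (a
`Finset` of indices): if `A` is open and path connected, the `B i` are open, path connected,
pairwise disjoint, with `A ∩ B i` path connected, and each `π₁(A ∩ B i, x i) → π₁(B i, x i)` is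
bijective (`x i ∈ A ∩ B i`), then `π₁(A, x₀) → π₁(A ∪ ⋃_{i ∈ s} B i, x₀)` is bijective for
every `x₀ ∈ A` (the pushout along an isomorphism, `bijective_inclHom_of_bijective_right`, one
piece at a time). [cite: HatcherAT2002, Thm. 1.20] -/
theorem bijective_inclHomOfSubset_union_biUnion (hAo : IsOpen A) (hBo : ∀ i, IsOpen (B i))
    (hApc : IsPathConnected A) (hBpc : ∀ i, IsPathConnected (B i))
    (hmeet : ∀ i, IsPathConnected (A ∩ B i)) (hdisj : Pairwise fun i j => Disjoint (B i) (B j))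
    (x : ι → Y) (hx : ∀ i, x i ∈ A ∩ B i)
    (hbij : ∀ i, Bijective (inclHomOfSubset (inter_subset_right : A ∩ B i ⊆ B i) (x i) (hx i)
      (hx i).2))
    (hx₀ : x₀ ∈ A) (s : Finset ι) :
    Bijective (inclHomOfSubset (subset_union_left : A ⊆ A ∪ ⋃ i ∈ s, B i) x₀ hx₀
      (subset_union_left hx₀)) := by
  classical
  induction s using Finset.induction_on with
  | empty =>
    have e : A ∪ ⋃ i ∈ (∅ : Finset ι), B i = A := by simp
    constructor
    · rw [injective_inclHomOfSubset_congr e _ subset_rfl hx₀]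
      intro a b hab
      rwa [inclHomOfSubset_refl_apply, inclHomOfSubset_refl_apply] at hab
    · rw [surjective_inclHomOfSubset_congr e _ subset_rfl hx₀]
      intro a
      exact ⟨a, inclHomOfSubset_refl_apply _ hx₀ a⟩
  | insert i s his ih =>
    set A' : Set Y := A ∪ ⋃ j ∈ s, B j with hA'
    have e : A ∪ ⋃ j ∈ insert i s, B j = A' ∪ B i := by
      rw [Finset.set_biUnion_insert, hA', union_assoc, union_comm (B i)]
    have hAA' : A ⊆ A' := subset_union_left
    have hA'o : IsOpen A' := isOpen_union_biUnion hAo hBo s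
    have hA'pc : IsPathConnected A' :=
      isPathConnected_union_biUnion hApc hBpc (fun j => ⟨x j, hx j⟩) s
    have hinter : A' ∩ B i = A ∩ B i := union_biUnion_inter_eq hdisj his
    have hmeet' : IsPathConnected (A' ∩ B i) := by rw [hinter]; exact hmeet i
    have hxi : x i ∈ A' ∩ B i := by rw [hinter]; exact hx i
    -- the edge of the new piece, read from `A'`
    have hbij' : Bijective (inclHomOfSubset (inter_subset_right : A' ∩ B i ⊆ B i) (x i) hxi hxi.2) :=
      ⟨(injective_inclHomOfSubset_congr' hinter.symm rfl _ _ (hx i) hxi).1 (hbij i).1,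
        (surjective_inclHomOfSubset_congr' hinter.symm rfl _ _ (hx i) hxi).1 (hbij i).2⟩
    -- one piece, at `x i`, then at `x₀`
    have hone := bijective_inclHomOfSubset_union_of_bijective hA'o (hBo i) hA'pc (hBpc i) hmeet'
      hxi hbij'
    obtain ⟨δ, hδ⟩ := hA'pc.joinedIn x₀ (hAA' hx₀) (x i) hxi.1
    have hq : Bijective (inclHomOfSubset (subset_union_left : A' ⊆ A' ∪ B i) x₀ (hAA' hx₀)
        (subset_union_left (hAA' hx₀))) :=
      ⟨(injective_inclHomOfSubset_iff_of_path (subset_union_left : A' ⊆ A' ∪ B i) (hAA' hx₀)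
          hxi.1 δ hδ).2 hone.1,
        (surjective_inclHomOfSubset_iff_of_path (subset_union_left : A' ⊆ A' ∪ B i) (hAA' hx₀)
          hxi.1 δ hδ).2 hone.2⟩
    -- compose with the induction hypothesis
    have hcomp : ∀ a, inclHomOfSubset (hAA'.trans (subset_union_left : A' ⊆ A' ∪ B i)) x₀ hx₀
        (subset_union_left (hAA' hx₀)) a =
          inclHomOfSubset (subset_union_left : A' ⊆ A' ∪ B i) x₀ (hAA' hx₀)
            (subset_union_left (hAA' hx₀)) (inclHomOfSubset hAA' x₀ hx₀ (hAA' hx₀) a) := fun a =>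
      (inclHomOfSubset_inclHomOfSubset hAA' (subset_union_left : A' ⊆ A' ∪ B i) hx₀ (hAA' hx₀)
        (subset_union_left (hAA' hx₀)) a).symm
    have hc : Bijective (inclHomOfSubset (hAA'.trans (subset_union_left : A' ⊆ A' ∪ B i)) x₀ hx₀
        (subset_union_left (hAA' hx₀))) := by
      have : (inclHomOfSubset (hAA'.trans (subset_union_left : A' ⊆ A' ∪ B i)) x₀ hx₀
          (subset_union_left (hAA' hx₀)) : _ → _) =
          (inclHomOfSubset (subset_union_left : A' ⊆ A' ∪ B i) x₀ (hAA' hx₀)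
            (subset_union_left (hAA' hx₀))) ∘ (inclHomOfSubset hAA' x₀ hx₀ (hAA' hx₀)) :=
        funext hcomp
      rw [this]
      exact hq.comp ih
    exact ⟨(injective_inclHomOfSubset_congr e _ (hAA'.trans (subset_union_left : A' ⊆ A' ∪ B i))
        hx₀).2 hc.1,
      (surjective_inclHomOfSubset_congr e _ (hAA'.trans (subset_union_left : A' ⊆ A' ∪ B i))
        hx₀).2 hc.2⟩

/-- **Bijectivity for a finite family of pairwise disjoint open pieces with isomorphic edges**
(`bijective_inclHomOfSubset_union_biUnion` for all indices of a finite type): the form in which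
removing finitely many disjoint cores of open tubes from a manifold does not change the
fundamental group (Kosinski X §2, `SphereCoreComplementPi1.lean` for one tube).
[cite: HatcherAT2002, Thm. 1.20] -/
theorem bijective_inclHomOfSubset_union_iUnion [Finite ι] (hAo : IsOpen A)
    (hBo : ∀ i, IsOpen (B i)) (hApc : IsPathConnected A) (hBpc : ∀ i, IsPathConnected (B i))
    (hmeet : ∀ i, IsPathConnected (A ∩ B i)) (hdisj : Pairwise fun i j => Disjoint (B i) (B j))
    (x : ι → Y) (hx : ∀ i, x i ∈ A ∩ B i)
    (hbij : ∀ i, Bijective (inclHomOfSubset (inter_subset_right : A ∩ B i ⊆ B i) (x i) (hx i)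
      (hx i).2))
    (hx₀ : x₀ ∈ A) :
    Bijective (inclHomOfSubset (subset_union_left : A ⊆ A ∪ ⋃ i, B i) x₀ hx₀
      (subset_union_left hx₀)) := by
  classical
  cases nonempty_fintype ι
  have e : A ∪ ⋃ i ∈ (Finset.univ : Finset ι), B i = A ∪ ⋃ i, B i := by
    ext y; simp
  have h := bijective_inclHomOfSubset_union_biUnion hAo hBo hApc hBpc hmeet hdisj x hx hbij hx₀
    Finset.univ
  exact ⟨(injective_inclHomOfSubset_congr e _ subset_union_left hx₀).1 h.1,
    (surjective_inclHomOfSubset_congr e _ subset_union_left hx₀).1 h.2⟩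

/-- **Bijectivity onto `π₁(Y)` when the pieces cover**: in the situation of
`bijective_inclHomOfSubset_union_iUnion`, if `A ∪ ⋃ Bᵢ = Y` then `π₁(A, x₀) → π₁(Y, x₀)`
(`inclHom A`) is bijective. [cite: HatcherAT2002, Thm. 1.20] -/
theorem bijective_inclHom_of_union_iUnion_eq_univ [Finite ι] (hAo : IsOpen A)
    (hBo : ∀ i, IsOpen (B i)) (hApc : IsPathConnected A) (hBpc : ∀ i, IsPathConnected (B i))
    (hmeet : ∀ i, IsPathConnected (A ∩ B i)) (hdisj : Pairwise fun i j => Disjoint (B i) (B j))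
    (hcov : A ∪ ⋃ i, B i = univ) (x : ι → Y) (hx : ∀ i, x i ∈ A ∩ B i)
    (hbij : ∀ i, Bijective (inclHomOfSubset (inter_subset_right : A ∩ B i ⊆ B i) (x i) (hx i)
      (hx i).2))
    (hx₀ : x₀ ∈ A) :
    Bijective (inclHom A x₀ hx₀) := by
  exact bijective_inclHom_of_bijective_inclHomOfSubset_univ hcov _ hx₀
    (bijective_inclHomOfSubset_union_iUnion hAo hBo hApc hBpc hmeet hdisj x hx hbij hx₀)

end Pieces

end VanKampen

end Literature.AlgebraicTopology.FundamentalGroup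

end
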